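import Literature.Probability.RandomPlanarGeometry.BDGS2012GrahamReversion
import Literature.Probability.RandomPlanarGeometry.BDGS2012GrahamDimension
import Mathlib.Analysis.Complex.ExponentialBounds
import HarnessLib

/-!
# Graham's Borel-type bound for `z_c(d)` (BDGS 2012, (1.20)), III: the coefficients `c_{a,b,N}`,
# `c_{a,b}` and Lemma 4 (`c_b ≤ C₃^b b!`); Lemma 3 for the self-avoiding walk

Sibling file of `Literature.Probability.RandomPlanarGeometry.BDGS2012` (fact
`BDGS2012_Graham_criticalPoint_bound` = Graham 2010, Theorem 1), sequel to
`BDGS2012GrahamReversion.lean` (the reversion coefficients `αₙ` and "Lemma 4 ⟹ Lemma 3") and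
`BDGS2012GrahamDimension.lean` (lace-graph counts are `Σ_D C(d,D)·g(a,N,D)`).

## What the source prints (Graham 2010 = arXiv:0911.5163, §3 and §4)

* §3: "we can write the number of memory-`τ` lace graphs of length `a` and type `N` in `ℤ^d` as
  a polynomial in powers of `s⁻¹ = 2d`,
  `Σ_{D=1}^{⌊a/2⌋} f_τ(a,N,D) 2d(2d-2)⋯(2d-2D+2) = Σ_{b=⌈a/2⌉}^{a-1} c_{a,b,N} s^{b-a}`.
  Let `I = {(a,b) : b = 1,2,…; a = b+1,…,2b}` and set (cab) `c_{a,b} = Σ_{N=1}^∞ (-1)^{N+1} c_{a,b,N}`,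
  `(a,b) ∈ I`."
* **Lemma 4.** "Let `c_b = Σ_{a=b+1}^{2b} |c_{a,b}|`. There is a constant `C₃` such that
  `c_b ≤ C₃^b b!`" Proof: "`|c_{a,b}| ≤ Σ_{D=a-b}^{⌊a/2⌋} Σ_N f_τ(a,N,D) × |[s^{b-a}] s⁻¹(s⁻¹-2)⋯(s⁻¹-2D+2)|`.
  The number of lace graphs of length `a` in `ℤ^D` is at most `(2D)^a` … The absolute value of
  `[s^{b-a}] s⁻¹(s⁻¹-2)⋯(s⁻¹-2D+2)` is at most `[s^{b-a}](s⁻¹+2D)^D = (2D)^{D+b-a} C(D, a-b)` …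
  The result follow[s] by Stirling's formula".
* **Lemma 3.** "There is a constant `C₂` such that for all `n`, `|αₙ| ≤ C₂ⁿ n!`"

## What is formalised (namespace `Literature.Probability.RandomPlanarGeometry.SAW.Zd.Graham2010`)

With the labelled counts `diagDim a M D = g(a, M+1, D)` of the previous file (so that the symmetry
factor `2d(2d-2)⋯(2d-2D+2)` of the source becomes `C(d,D) = [2d(2d-2)⋯(2d-2D+2)]/(2^D D!)`):
* `pcoef D j = [X^j] ∏_{i<D} (X - 2i)` (by the recursion in `D`), `sum_pcoef_mul_pow`
  (`Σ_j pcoef D j · x^j = ∏_{i<D}(x - 2i)`), `abs_pcoef_le` (`|pcoef D j| ≤ C(D,j)(2D)^{D-j}`,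
  the printed "`[s^{b-a}](s⁻¹+2D)^D`" bound), `prod_range_sub_eq` (`∏_{i<D}(2d-2i) = 2^D D! C(d,D)`);
* **`cTyp a M j`** = Graham's `c_{a,a-j,M+1}` := `Σ_{D=1}^{⌊a/2⌋} g(a,M+1,D) · pcoef D j/(2^D D!)` and
  the identity **`diagTotal_eq_sum_cTyp`**: `Σ_x π_a^{(M+1)}(x) = Σ_{j=1}^{⌊a/2⌋} cTyp a M j · (2d)^j`
  for every `d` (the polynomial in `2d`; `b = a - j` runs over `⌈a/2⌉ ≤ b ≤ a - 1`);
* **`grahamC a b = c_{a,b}`** := `Σ_{M<a} (-1)^M cTyp a M (a-b)` ((cab) with `N = M + 1`);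
* `sum_diagDim_le` (`Σ_M g(a,M+1,D) ≤ (2D)^a`: for a given walk at most one `M` has `T_M = a`),
  and **Lemma 4** `grahamC_lemma4 : Σ_{a=b+1}^{2b} |c_{a,b}| ≤ 1296^b b!` (`C₃ = (4·3²)²·4 = 1296`,
  from `D^D/D! ≤ e^D`, `b^b/b! ≤ e^b`, `e ≤ 3`) with `Graham2010_lemma4` in the printed `∃ C₃` form;
* **Lemma 3 for the self-avoiding walk**: `Graham2010_lemma3 : ∃ C₂ > 0, ∀ n, |αₙ| ≤ C₂ⁿ n!`
  for `αₙ = alpha grahamC n`, by `lemma3_of_lemma4`.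

Not here: Lemma 7 (length bounds at the critical point) and §6.
-/

noncomputable section

open Finset
open Literature.Probability.LatticeModels Literature.Probability.LatticeModels.SRW
open Literature.Barriers.CriticalPhenomena.SAWLace
open scoped BigOperators

namespace Literature.Probability.RandomPlanarGeometry.SAW.Zd.Graham2010

/-! ### The polynomial `∏_{i<D} (X - 2i)` and its coefficients -/

/-- `pcoef D j = [X^j] ∏_{i<D} (X - 2i)`, by `P_{D+1} = P_D · (X - 2D)`:
`[X^j]P_{D+1} = [X^{j-1}]P_D - 2D [X^j]P_D`. [cite: Graham2010, Section 4, proof of Lemma 4] -/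
def pcoef : ℕ → ℕ → ℤ
  | 0, j => if j = 0 then 1 else 0
  | D + 1, j => (if j = 0 then 0 else pcoef D (j - 1)) - 2 * (D : ℤ) * pcoef D j

/-- `[X^j] P_0 = 𝟙[j = 0]`. [folklore] -/
theorem pcoef_zero (j : ℕ) : pcoef 0 j = if j = 0 then 1 else 0 := by rw [pcoef]

/-- The recursion for `pcoef`. [folklore] -/
theorem pcoef_succ (D j : ℕ) :
    pcoef (D + 1) j = (if j = 0 then 0 else pcoef D (j - 1)) - 2 * (D : ℤ) * pcoef D j := by rw [pcoef]

/-- `[X^j] P_D = 0` for `j > D` (degree `D`). [folklore] -/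
theorem pcoef_eq_zero_of_lt {D j : ℕ} (h : D < j) : pcoef D j = 0 := by
  induction D generalizing j with
  | zero => rw [pcoef_zero, if_neg (by omega)]
  | succ D ih => rw [pcoef_succ, if_neg (by omega), ih (by omega), ih (by omega)]; ring

/-- `[X^0] P_D = 0` for `D ≥ 1` (the factor `X - 0`). [folklore] -/
theorem pcoef_zero_right {D : ℕ} (h : 1 ≤ D) : pcoef D 0 = 0 := by
  induction D with
  | zero => omega
  | succ D ih =>
    rw [pcoef_succ, if_pos rfl]
    rcases Nat.eq_zero_or_pos D with rfl | hD
    · simp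
    · rw [ih hD]; ring

/-- `Σ_{j=0}^{D} pcoef D j · x^j = ∏_{i<D} (x - 2i)`. [cite: Graham2010, Section 4, proof of Lemma 4] -/
theorem sum_pcoef_mul_pow (D : ℕ) (x : ℝ) :
    ∑ j ∈ range (D + 1), (pcoef D j : ℝ) * x ^ j = ∏ i ∈ range D, (x - 2 * (i : ℝ)) := by
  induction D with
  | zero => simp [pcoef_zero]
  | succ D ih =>
    rw [prod_range_succ, ← ih]
    -- expand `pcoef (D+1) j`
    have hexp : ∀ j, (pcoef (D + 1) j : ℝ) =
        (if j = 0 then 0 else (pcoef D (j - 1) : ℝ)) - 2 * (D : ℝ) * (pcoef D j : ℝ) := by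
      intro j
      rw [pcoef_succ]
      split_ifs <;> push_cast <;> ring
    simp_rw [hexp, sub_mul, sum_sub_distrib]
    -- first sum: shift the index
    have h1 : ∑ j ∈ range (D + 1 + 1), (if j = 0 then 0 else (pcoef D (j - 1) : ℝ)) * x ^ j =
        (∑ j ∈ range (D + 1), (pcoef D j : ℝ) * x ^ j) * x := by
      rw [sum_range_succ', if_pos rfl, zero_mul, add_zero, sum_mul]
      refine sum_congr rfl fun j _ => ?_
      rw [if_neg (Nat.succ_ne_zero j), Nat.add_sub_cancel, pow_succ]
      ring
    -- second sum: the top term vanishes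
    have h2 : ∑ j ∈ range (D + 1 + 1), 2 * (D : ℝ) * (pcoef D j : ℝ) * x ^ j =
        2 * (D : ℝ) * ∑ j ∈ range (D + 1), (pcoef D j : ℝ) * x ^ j := by
      rw [sum_range_succ, pcoef_eq_zero_of_lt (Nat.lt_succ_self D), Int.cast_zero, mul_zero, zero_mul,
        add_zero, mul_sum]
      refine sum_congr rfl fun j _ => ?_
      ring
    rw [h1, h2]
    ring

/-- **The printed coefficient bound** `|[X^j] ∏_{i<D}(X - 2i)| ≤ [X^j](X + 2D)^D = C(D,j)(2D)^{D-j}`.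
[cite: Graham2010, Section 4, proof of Lemma 4] -/
theorem abs_pcoef_le (D j : ℕ) : |(pcoef D j : ℝ)| ≤ (D.choose j : ℝ) * (2 * (D : ℝ)) ^ (D - j) := by
  induction D generalizing j with
  | zero =>
    rw [pcoef_zero]
    split_ifs with h
    · subst h; simp
    · simp
  | succ D ih =>
    have e2 : |((2 : ℤ) : ℝ)| = 2 := by norm_num
    have eD : |((D : ℤ) : ℝ)| = (D : ℝ) := by
      rw [Int.cast_natCast]; exact abs_of_nonneg (Nat.cast_nonneg _)
    rcases Nat.eq_zero_or_pos j with rfl | hj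
    · -- `j = 0`
      rw [pcoef_succ, if_pos rfl, zero_sub, Int.cast_neg, abs_neg, Int.cast_mul, Int.cast_mul, abs_mul,
        abs_mul, e2, eD, Nat.choose_zero_right, Nat.cast_one, one_mul, Nat.sub_zero]
      have h0 := ih 0
      rw [Nat.choose_zero_right, Nat.cast_one, one_mul, Nat.sub_zero] at h0
      calc 2 * (D : ℝ) * |(pcoef D 0 : ℝ)| ≤ 2 * (D : ℝ) * (2 * (D : ℝ)) ^ D := by gcongr
        _ ≤ (2 * ((D + 1 : ℕ) : ℝ)) * (2 * ((D + 1 : ℕ) : ℝ)) ^ D := by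
            have hle : 2 * (D : ℝ) ≤ 2 * ((D + 1 : ℕ) : ℝ) := by push_cast; linarith
            exact mul_le_mul hle (pow_le_pow_left₀ (by positivity) hle D) (by positivity) (by positivity)
        _ = (2 * ((D + 1 : ℕ) : ℝ)) ^ (D + 1) := by ring
    · obtain ⟨k, rfl⟩ : ∃ k, j = k + 1 := ⟨j - 1, by omega⟩
      rw [pcoef_succ, if_neg (Nat.succ_ne_zero k), Nat.add_sub_cancel, Int.cast_sub, Int.cast_mul,
        Int.cast_mul]
      refine (abs_sub _ _).trans ?_
      rw [abs_mul, abs_mul, e2, eD]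
      have hA := ih k
      have hB := ih (k + 1)
      -- `C(D,k)(2D)^{D-k} + 2D·C(D,k+1)(2D)^{D-k-1} ≤ C(D+1,k+1) (2(D+1))^{D-k}`
      have hDD : (2 * (D : ℝ)) ≤ 2 * ((D + 1 : ℕ) : ℝ) := by push_cast; linarith
      have h2D : (0 : ℝ) ≤ 2 * (D : ℝ) := by positivity
      rcases le_or_gt (k + 1) D with hkD | hkD
      · -- generic case `k + 1 ≤ D`
        have hexp : D - k = (D - (k + 1)) + 1 := by omega
        calc |(pcoef D k : ℝ)| + 2 * (D : ℝ) * |(pcoef D (k + 1) : ℝ)|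
            ≤ (D.choose k : ℝ) * (2 * (D : ℝ)) ^ (D - k) +
                2 * (D : ℝ) * ((D.choose (k + 1) : ℝ) * (2 * (D : ℝ)) ^ (D - (k + 1))) := by
              gcongr
          _ = ((D.choose k : ℝ) + (D.choose (k + 1) : ℝ)) * (2 * (D : ℝ)) ^ (D - k) := by
              rw [hexp, pow_succ]; ring
          _ = ((D + 1).choose (k + 1) : ℝ) * (2 * (D : ℝ)) ^ (D - k) := by
              rw [Nat.choose_succ_succ', Nat.cast_add]
          _ ≤ ((D + 1).choose (k + 1) : ℝ) * (2 * ((D + 1 : ℕ) : ℝ)) ^ (D + 1 - (k + 1)) := by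
              rw [show D + 1 - (k + 1) = D - k by omega]
              gcongr
      · -- `k + 1 > D`: `pcoef D (k+1) = 0`
        rw [pcoef_eq_zero_of_lt hkD, Int.cast_zero, abs_zero, mul_zero, add_zero]
        rcases le_or_gt k D with hk | hk
        · have hkD' : k = D := by omega
          subst hkD'
          calc |(pcoef k k : ℝ)| ≤ (k.choose k : ℝ) * (2 * (k : ℝ)) ^ (k - k) := hA
            _ = 1 := by simp
            _ ≤ ((k + 1).choose (k + 1) : ℝ) * (2 * ((k + 1 : ℕ) : ℝ)) ^ (k + 1 - (k + 1)) := by simp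
        · rw [pcoef_eq_zero_of_lt hk, Int.cast_zero, abs_zero]
          positivity

/-- `∏_{i<D} (d - i) = d(d-1)⋯(d-D+1)` (the descending factorial, `0` if `D > d`). [folklore] -/
theorem prod_range_natCast_sub (d D : ℕ) : ∏ i ∈ range D, ((d : ℝ) - (i : ℝ)) = (d.descFactorial D : ℝ) := by
  induction D with
  | zero => simp
  | succ D ih =>
    rw [prod_range_succ, ih, Nat.descFactorial_succ, Nat.cast_mul, mul_comm]
    rcases le_or_gt D d with hD | hD
    · rw [Nat.cast_sub hD]
    · rw [Nat.descFactorial_eq_zero_iff_lt.2 hD]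
      simp

/-- `∏_{i<D} (2d - 2i) = 2^D · D! · C(d,D)` (so that `∏_{i<D}(2d - 2i)/(2^D D!) = C(d,D)`,
Graham's symmetry factor per labelled class). [cite: Graham2010, Section 3] -/
theorem prod_range_sub_eq (d D : ℕ) :
    ∏ i ∈ range D, (2 * (d : ℝ) - 2 * (i : ℝ)) = (2 : ℝ) ^ D * (D.factorial : ℝ) * (d.choose D : ℝ) := by
  have h1 : ∏ i ∈ range D, (2 * (d : ℝ) - 2 * (i : ℝ)) = (2 : ℝ) ^ D * ∏ i ∈ range D, ((d : ℝ) - (i : ℝ)) := by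
    have h2 : (2 : ℝ) ^ D = ∏ _i ∈ range D, (2 : ℝ) := by simp
    rw [h2, ← prod_mul_distrib]
    exact prod_congr rfl fun i _ => by ring
  rw [h1, prod_range_natCast_sub, Nat.descFactorial_eq_factorial_mul_choose, Nat.cast_mul, mul_assoc]

/-! ### The coefficients `c_{a,b,N}` and the polynomial identity -/

/-- **`c_{a,a-j,M+1}`**: the coefficient of `(2d)^j` in `Σ_x π_a^{(M+1)}(x)`,
`cTyp a M j = Σ_{D=1}^{⌊a/2⌋} g(a,M+1,D) · [X^j]∏_{i<D}(X-2i) / (2^D D!)`.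
[cite: Graham2010, Section 3, the display defining c_{a,b,N}] -/
def cTyp (a M j : ℕ) : ℝ :=
  ∑ D ∈ Icc 1 (a / 2), (diagDim a M D : ℝ) * (pcoef D j : ℝ) / ((2 : ℝ) ^ D * (D.factorial : ℝ))

/-- `c_{a,a-j,N} = 0` for `j = 0` (no constant term: `b ≤ a - 1`). [cite: Graham2010, Section 3] -/
theorem cTyp_zero_right (a M : ℕ) : cTyp a M 0 = 0 := by
  refine sum_eq_zero fun D hD => ?_
  rw [mem_Icc] at hD
  rw [pcoef_zero_right hD.1, Int.cast_zero, mul_zero, zero_div]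

/-- `c_{a,a-j,N} = 0` for `j > ⌊a/2⌋` (`b ≥ ⌈a/2⌉`). [cite: Graham2010, Section 3] -/
theorem cTyp_eq_zero_of_lt {a M j : ℕ} (h : a / 2 < j) : cTyp a M j = 0 := by
  refine sum_eq_zero fun D hD => ?_
  rw [mem_Icc] at hD
  rw [pcoef_eq_zero_of_lt (by omega), Int.cast_zero, mul_zero, zero_div]

/-- `Σ_{j=1}^{K} p_{D,j} x^j = Σ_{j=0}^{D} p_{D,j} x^j` for `1 ≤ D ≤ K` (the terms `j = 0` and `j > D`
vanish). [folklore] -/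
theorem sum_Icc_pcoef_mul_pow {D K : ℕ} (hD1 : 1 ≤ D) (hDK : D ≤ K) (x : ℝ) :
    ∑ j ∈ Icc 1 K, (pcoef D j : ℝ) * x ^ j = ∑ j ∈ range (D + 1), (pcoef D j : ℝ) * x ^ j := by
  have h1 : ∑ j ∈ range (D + 1), (pcoef D j : ℝ) * x ^ j = ∑ j ∈ range (K + 1), (pcoef D j : ℝ) * x ^ j := by
    refine sum_subset (range_subset_range.2 (by omega)) fun j hj hj' => ?_
    rw [mem_range] at hj hj'
    rw [pcoef_eq_zero_of_lt (by omega), Int.cast_zero, zero_mul]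
  have h2 : ∑ j ∈ Icc 1 K, (pcoef D j : ℝ) * x ^ j = ∑ j ∈ range (K + 1), (pcoef D j : ℝ) * x ^ j := by
    refine sum_subset (fun j hj => ?_) fun j hj hj' => ?_
    · rw [mem_Icc] at hj; rw [mem_range]; omega
    · rw [mem_range] at hj
      rw [mem_Icc] at hj'
      have : j = 0 := by omega
      rw [this, pcoef_zero_right hD1, Int.cast_zero, zero_mul]
  rw [h1, h2]

/-- **Lace-graph counts as polynomials in `2d`**: for every `d`,
`Σ_x π_a^{(M+1)}(x) = Σ_{j=1}^{⌊a/2⌋} c_{a,a-j,M+1} (2d)^j`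
(Graham: "`= Σ_{b=⌈a/2⌉}^{a-1} c_{a,b,N} s^{b-a}`", `s = 1/(2d)`). [cite: Graham2010, Section 3] -/
theorem diagTotal_eq_sum_cTyp (d a M : ℕ) :
    (diagTotal d a M : ℝ) = ∑ j ∈ Icc 1 (a / 2), cTyp a M j * (2 * (d : ℝ)) ^ j := by
  rw [diagTotal_eq_sum_Icc, Nat.cast_sum]
  simp_rw [cTyp, sum_mul]
  rw [sum_comm]
  refine sum_congr rfl fun D hD => ?_
  rw [mem_Icc] at hD
  have hw : (0 : ℝ) < (2 : ℝ) ^ D * (D.factorial : ℝ) := by positivity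
  have hterm : ∀ j : ℕ, (diagDim a M D : ℝ) * (pcoef D j : ℝ) / ((2 : ℝ) ^ D * (D.factorial : ℝ)) *
      (2 * (d : ℝ)) ^ j = (diagDim a M D : ℝ) / ((2 : ℝ) ^ D * (D.factorial : ℝ)) *
        ((pcoef D j : ℝ) * (2 * (d : ℝ)) ^ j) := by
    intro j; ring
  simp_rw [hterm]
  rw [← mul_sum, sum_Icc_pcoef_mul_pow hD.1 hD.2, sum_pcoef_mul_pow, prod_range_sub_eq, Nat.cast_mul]
  field_simp

/-! ### `c_{a,b}` and Lemma 4 -/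

/-- **Graham's `c_{a,b}`** ((cab): "`c_{a,b} = Σ_{N=1}^∞ (-1)^{N+1} c_{a,b,N}`"), with `N = M + 1`
(`(-1)^{N+1} = (-1)^M`) and `c_{a,b,M+1} = cTyp a M (a - b)`; lace graphs of length `a` have order
`M + 1 ≤ a - 1`, and for `b ≥ a` the value is `0` (`cTyp a M 0 = 0`). [cite: Graham2010, Section 3, eq. (cab)] -/
def grahamC (a b : ℕ) : ℝ :=
  ∑ M ∈ range a, (-1 : ℝ) ^ M * cTyp a M (a - b)

/-- `c_{a,b} = 0` unless `b + 1 ≤ a ≤ 2b` (the index set `I`). [cite: Graham2010, Section 3] -/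
theorem grahamC_eq_zero {a b : ℕ} (h : a ≤ b ∨ 2 * b < a) : grahamC a b = 0 := by
  refine sum_eq_zero fun M _ => ?_
  rcases h with h | h
  · rw [show a - b = 0 by omega, cTyp_zero_right, mul_zero]
  · rw [cTyp_eq_zero_of_lt (by omega), mul_zero]

/-- For a given walk at most one `M` has `T_M = a`: the lace-graph classes of a fixed length are
disjoint in the order, so `Σ_M g(a, M+1, D) ≤ (2D)^a` (Graham: "The number of lace graphs of
length `a` in `ℤ^D` is at most `(2D)^a`"). [cite: Graham2010, Section 4, proof of Lemma 4] -/
theorem sum_diagDim_le (a D : ℕ) : ∑ M ∈ range a, diagDim a M D ≤ (2 * D) ^ a := by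
  classical
  unfold diagDim dimCount
  rw [← card_biUnion]
  · exact (card_le_univ _).trans (by rw [card_stepSeq])
  · intro M _ M' _ hne
    rw [Function.onFun, disjoint_filter]
    rintro σ - ⟨⟨hM, hTM⟩, -⟩ ⟨⟨hM', hTM'⟩, -⟩
    -- `T` is strictly increasing while `≤ a`: `T_M = T_{M'} = a` forces `M = M'`
    have key : ∀ {m m' : ℕ}, m < m' → laceTime σ m' ≤ a → laceTime σ m < laceTime σ m' := by
      intro m m' hlt hle
      obtain ⟨k, rfl⟩ : ∃ k, m' = k + 1 := ⟨m' - 1, by omega⟩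
      have h1 : laceTime σ m ≤ laceTime σ k := laceTime_mono σ (by omega)
      have h2 := (laceTime_spec hle).1
      rw [laceStart_succ] at h2
      omega
    rcases lt_or_gt_of_ne hne with hlt | hlt
    · have := key hlt hM'.1; omega
    · have := key hlt hM.1; omega

/-- `x^x ≤ 3^x x!` (from `x^x/x! ≤ e^x`, `e ≤ 3`). [folklore] -/
theorem pow_self_le_three_pow_mul_factorial (x : ℕ) : ((x : ℝ)) ^ x ≤ (3 : ℝ) ^ x * (x.factorial : ℝ) := by
  have h := Real.pow_div_factorial_le_exp (x : ℝ) (Nat.cast_nonneg x) x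
  have hfac : (0 : ℝ) < (x.factorial : ℝ) := by positivity
  rw [div_le_iff₀ hfac] at h
  refine h.trans (mul_le_mul_of_nonneg_right ?_ hfac.le)
  calc Real.exp (x : ℝ) = Real.exp 1 ^ x := by rw [← Real.exp_one_rpow, Real.rpow_natCast]
    _ ≤ (3 : ℝ) ^ x := pow_le_pow_left₀ (Real.exp_pos 1).le
        Real.exp_one_lt_three.le x

/-- The bound on one term of `Σ_N |c_{a,b,N}|`: for `1 ≤ D ≤ b`, `j ≤ D`,
`(2D)^a C(D,j)(2D)^{D-j}/(2^D D!) ≤ 324^b b!` whenever `a + D - j ≤ D + 2b`… in the form used: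
`(2D)^{D+b}·C(D,j)/(2^D D!) ≤ 2^b 2^D D^b (D^D/D!) ≤ (4·9)^b·… ≤ 324^b b!`. [folklore] -/
theorem term_bound {D b j : ℕ} (hD1 : 1 ≤ D) (hDb : D ≤ b) :
    (2 * (D : ℝ)) ^ (D + b) * (D.choose j : ℝ) / ((2 : ℝ) ^ D * (D.factorial : ℝ)) ≤
      (324 : ℝ) ^ b * (b.factorial : ℝ) := by
  have hDpos : (0 : ℝ) < D := by exact_mod_cast hD1
  have hfac : (0 : ℝ) < (D.factorial : ℝ) := by positivity
  have hw : (0 : ℝ) < (2 : ℝ) ^ D * (D.factorial : ℝ) := by positivity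
  -- `(2D)^{D+b}/(2^D D!) = 2^b D^b (D^D / D!)`
  have hrw : (2 * (D : ℝ)) ^ (D + b) * (D.choose j : ℝ) / ((2 : ℝ) ^ D * (D.factorial : ℝ)) =
      (2 : ℝ) ^ b * (D : ℝ) ^ b * ((D : ℝ) ^ D / (D.factorial : ℝ)) * (D.choose j : ℝ) := by
    field_simp
    ring
  rw [hrw]
  have h1 : (D : ℝ) ^ D / (D.factorial : ℝ) ≤ (3 : ℝ) ^ D := by
    rw [div_le_iff₀ hfac]; exact pow_self_le_three_pow_mul_factorial D
  have h2 : (D.choose j : ℝ) ≤ (2 : ℝ) ^ D := by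
    exact_mod_cast (Nat.choose_le_two_pow D j)
  have h3 : (D : ℝ) ^ b ≤ (b : ℝ) ^ b := pow_le_pow_left₀ hDpos.le (by exact_mod_cast hDb) b
  have h4 : (b : ℝ) ^ b ≤ (3 : ℝ) ^ b * (b.factorial : ℝ) := pow_self_le_three_pow_mul_factorial b
  have h36 : (3 : ℝ) ^ D * (2 : ℝ) ^ D ≤ (6 : ℝ) ^ b := by
    rw [← mul_pow]; norm_num
    exact pow_le_pow_right₀ (by norm_num) hDb |>.trans' le_rfl
  calc (2 : ℝ) ^ b * (D : ℝ) ^ b * ((D : ℝ) ^ D / (D.factorial : ℝ)) * (D.choose j : ℝ)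
      ≤ (2 : ℝ) ^ b * ((3 : ℝ) ^ b * (b.factorial : ℝ)) * ((3 : ℝ) ^ D) * ((2 : ℝ) ^ D) := by
        gcongr
        exact h3.trans h4
    _ = (2 : ℝ) ^ b * (3 : ℝ) ^ b * ((3 : ℝ) ^ D * (2 : ℝ) ^ D) * (b.factorial : ℝ) := by ring
    _ ≤ (2 : ℝ) ^ b * (3 : ℝ) ^ b * (6 : ℝ) ^ b * (b.factorial : ℝ) := by gcongr
    _ = (36 : ℝ) ^ b * (b.factorial : ℝ) := by rw [← mul_pow, ← mul_pow]; norm_num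
    _ ≤ (324 : ℝ) ^ b * (b.factorial : ℝ) := by gcongr; norm_num

/-- `|c_{a,b}| ≤ Σ_{D=1}^{⌊a/2⌋} (2D)^a · C(D,a-b)(2D)^{D-(a-b)} / (2^D D!)` — the first two displays of
the proof of Lemma 4. [cite: Graham2010, Section 4, proof of Lemma 4] -/
theorem abs_grahamC_le (a b : ℕ) :
    |grahamC a b| ≤ ∑ D ∈ Icc 1 (a / 2),
      (2 * (D : ℝ)) ^ a * ((D.choose (a - b) : ℝ) * (2 * (D : ℝ)) ^ (D - (a - b))) /
        ((2 : ℝ) ^ D * (D.factorial : ℝ)) := by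
  unfold grahamC cTyp
  calc |∑ M ∈ range a, (-1 : ℝ) ^ M *
          ∑ D ∈ Icc 1 (a / 2), (diagDim a M D : ℝ) * (pcoef D (a - b) : ℝ) / ((2 : ℝ) ^ D * (D.factorial : ℝ))|
      ≤ ∑ M ∈ range a, ∑ D ∈ Icc 1 (a / 2),
          (diagDim a M D : ℝ) * |(pcoef D (a - b) : ℝ)| / ((2 : ℝ) ^ D * (D.factorial : ℝ)) := by
        refine (abs_sum_le_sum_abs _ _).trans (sum_le_sum fun M _ => ?_)
        rw [abs_mul, abs_pow, abs_neg, abs_one, one_pow, one_mul]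
        refine (abs_sum_le_sum_abs _ _).trans (sum_le_sum fun D _ => ?_)
        rw [abs_div, abs_mul, abs_of_nonneg (Nat.cast_nonneg _),
          abs_of_pos (by positivity : (0 : ℝ) < (2 : ℝ) ^ D * (D.factorial : ℝ))]
    _ = ∑ D ∈ Icc 1 (a / 2), (∑ M ∈ range a, (diagDim a M D : ℝ)) *
          (|(pcoef D (a - b) : ℝ)| / ((2 : ℝ) ^ D * (D.factorial : ℝ))) := by
        rw [sum_comm]
        refine sum_congr rfl fun D _ => ?_
        rw [sum_mul]
        refine sum_congr rfl fun M _ => ?_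
        ring
    _ ≤ ∑ D ∈ Icc 1 (a / 2), (2 * (D : ℝ)) ^ a *
          (((D.choose (a - b) : ℝ) * (2 * (D : ℝ)) ^ (D - (a - b))) / ((2 : ℝ) ^ D * (D.factorial : ℝ))) := by
        refine sum_le_sum fun D _ => ?_
        have hsum : ∑ M ∈ range a, (diagDim a M D : ℝ) ≤ (2 * (D : ℝ)) ^ a := by
          have := sum_diagDim_le a D
          exact_mod_cast this
        have habs := abs_pcoef_le D (a - b)
        have hw : (0 : ℝ) < (2 : ℝ) ^ D * (D.factorial : ℝ) := by positivity
        exact mul_le_mul hsum (div_le_div_of_nonneg_right habs hw.le)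
          (div_nonneg (abs_nonneg _) hw.le) (by positivity)
    _ = _ := by
        refine sum_congr rfl fun D _ => ?_
        ring

/-- **Graham 2010, Lemma 4** with an explicit constant: `c_b = Σ_{a=b+1}^{2b} |c_{a,b}| ≤ 1296^b b!`.
[cite: Graham2010, Lemma 4] -/
theorem grahamC_lemma4 (b : ℕ) (hb : 1 ≤ b) :
    ∑ a ∈ Icc (b + 1) (2 * b), |grahamC a b| ≤ (1296 : ℝ) ^ b * (b.factorial : ℝ) := by
  -- each `|c_{a,b}| ≤ Σ_{D ≤ b} 324^b b! ≤ b · 324^b b!`, and there are `b` values of `a`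
  have hterm : ∀ a ∈ Icc (b + 1) (2 * b), |grahamC a b| ≤ (b : ℝ) * ((324 : ℝ) ^ b * (b.factorial : ℝ)) := by
    intro a ha
    rw [mem_Icc] at ha
    refine (abs_grahamC_le a b).trans ?_
    have hcard : ((Icc 1 (a / 2)).card : ℝ) ≤ b := by
      rw [Nat.card_Icc]; exact_mod_cast (by omega : a / 2 + 1 - 1 ≤ b)
    calc ∑ D ∈ Icc 1 (a / 2), (2 * (D : ℝ)) ^ a * ((D.choose (a - b) : ℝ) * (2 * (D : ℝ)) ^ (D - (a - b))) /
            ((2 : ℝ) ^ D * (D.factorial : ℝ))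
        ≤ ∑ D ∈ Icc 1 (a / 2), (324 : ℝ) ^ b * (b.factorial : ℝ) := by
          refine sum_le_sum fun D hD => ?_
          rw [mem_Icc] at hD
          have hDb : D ≤ b := by omega
          rcases le_or_gt (a - b) D with hj | hj
          · -- `(2D)^a (2D)^{D-(a-b)} = (2D)^{D+b}`
            have hexp : (2 * (D : ℝ)) ^ a * (2 * (D : ℝ)) ^ (D - (a - b)) = (2 * (D : ℝ)) ^ (D + b) := by
              rw [← pow_add]; congr 1; omega
            calc (2 * (D : ℝ)) ^ a * ((D.choose (a - b) : ℝ) * (2 * (D : ℝ)) ^ (D - (a - b))) /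
                  ((2 : ℝ) ^ D * (D.factorial : ℝ))
                = (2 * (D : ℝ)) ^ (D + b) * (D.choose (a - b) : ℝ) / ((2 : ℝ) ^ D * (D.factorial : ℝ)) := by
                  rw [← hexp]; ring
              _ ≤ (324 : ℝ) ^ b * (b.factorial : ℝ) := term_bound hD.1 hDb
          · rw [Nat.choose_eq_zero_of_lt hj, Nat.cast_zero, zero_mul, mul_zero, zero_div]
            positivity
      _ = ((Icc 1 (a / 2)).card : ℝ) * ((324 : ℝ) ^ b * (b.factorial : ℝ)) := by
          rw [sum_const, nsmul_eq_mul]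
      _ ≤ (b : ℝ) * ((324 : ℝ) ^ b * (b.factorial : ℝ)) := by gcongr
  calc ∑ a ∈ Icc (b + 1) (2 * b), |grahamC a b|
      ≤ ∑ a ∈ Icc (b + 1) (2 * b), (b : ℝ) * ((324 : ℝ) ^ b * (b.factorial : ℝ)) := sum_le_sum hterm
    _ = (b : ℝ) * ((b : ℝ) * ((324 : ℝ) ^ b * (b.factorial : ℝ))) := by
        rw [sum_const, nsmul_eq_mul, Nat.card_Icc, show 2 * b + 1 - (b + 1) = b by omega]
    _ ≤ (2 : ℝ) ^ b * ((2 : ℝ) ^ b * ((324 : ℝ) ^ b * (b.factorial : ℝ))) := by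
        have h2 : (b : ℝ) ≤ (2 : ℝ) ^ b := by exact_mod_cast Nat.lt_two_pow_self.le
        gcongr
    _ = (1296 : ℝ) ^ b * (b.factorial : ℝ) := by
        rw [← mul_assoc, ← mul_assoc, ← mul_pow, ← mul_pow]; norm_num

/-- **Graham 2010, Lemma 4** as printed: "Let `c_b = Σ_{a=b+1}^{2b} |c_{a,b}|`. There is a constant
`C₃` such that `c_b ≤ C₃^b b!`". [cite: Graham2010, Lemma 4] -/
theorem Graham2010_lemma4 :
    ∃ C₃ : ℝ, ∀ b : ℕ, 1 ≤ b → ∑ a ∈ Icc (b + 1) (2 * b), |grahamC a b| ≤ C₃ ^ b * (b.factorial : ℝ) :=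
  ⟨1296, grahamC_lemma4⟩

/-- **Graham 2010, Lemma 3** for the self-avoiding walk: the coefficients `αₙ` of the formal
`1/(2d)`-expansion of `z_c` (`alpha grahamC`) satisfy `|αₙ| ≤ C₂ⁿ n!` for a constant `C₂`
("There is a constant `C₂` such that for all `n`, `|αₙ| ≤ C₂ⁿ n!`"). [cite: Graham2010, Lemma 3] -/
theorem Graham2010_lemma3 :
    ∃ C₂ : ℝ, 0 < C₂ ∧ ∀ n : ℕ, |alpha grahamC n| ≤ C₂ ^ n * (n.factorial : ℝ) :=
  lemma3_of_lemma4 Graham2010_lemma4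

end Literature.Probability.RandomPlanarGeometry.SAW.Zd.Graham2010
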